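import Summits.BirchSwinnertonDyer.BirchSwinnertonDyer.Theses.UniversalToricDescent
import Summits.BirchSwinnertonDyer.BirchSwinnertonDyer.Theorems.SchneiderFreeAdditiveX3KYBranchHalvesLambdaLe
import Summits.BirchSwinnertonDyer.BirchSwinnertonDyer.Theorems.EisensteinPrimesHidaLimitFittingBoundConverse
import Summits.BirchSwinnertonDyer.Rank1Residual.X2.HidaLimitCongruenceAlgebra
import Summits.BirchSwinnertonDyer.Rank1Residual.X11b.BDPRouteOpenInputDegenerateFrame
import Literature.NumberTheory.GaloisRepresentations.NearlyOrdinaryPresentationProofs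
import Literature.AlgebraicGeometry.Resolution.RegularLocalRingsUFD
import HarnessLib

/-!
# NODE (D-0171) on crux stmt-BirchSwinnertonDyer-24207 `UniversalToricDescent.RationalSplitIMCInclusionAtThree`
# — line `rootwise-eisenstein-simple-zeros` (crux-ideate seat `cruxidea-stmt-BirchSwinnertonDyer-24207-1` gen 28, 2026-08-31)

KIND: IMPLIED-BY (a sufficient quintuple; not an equivalence with the crux — no child route; `no_new_routes`).  BSD is proved for no
curve here.  `closes`-analogue CHECKED below (kernel, 0 sorry, BY NAME):
`rationalSplitIMCInclusionAtThree_of_rootwiseEisenstein_of_multipleZeros :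
   SquareCharGeneratorAtThree → SquareRootLFunctionAtThree → RootwiseEisensteinAtThree → MultipleZeroMultiplicityAtThree →
   CharLambdaDominanceAtThree → UTD.RationalSplitIMCInclusionAtThree`.

THE MOVE (EXISTENCE ∣ MULTIPLICITY split of the EISENSTEIN inclusion; «one class per SIMPLE zero»).  Gen 0's λ-flip
(`NodeEisensteinKatoSwapG0`) feeds 24207 from the REVERSE rational inclusion P1 `∃ k, 3ᵏ·Ch_Λ(X_(∅,0))·R₀⟦T⟧ ⊆ (L)` plus the
one-sided degree dominance P2 `λ(Ch) ≤ λ(L)` (the twin's Kato half, transported).  P1 is a statement WITH MULTIPLICITY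
(`ord_𝔮 Ch ≥ ord_𝔮 L` at every height-one `𝔮 ≠ (3)`) — what a Λ-adic Eisenstein-ideal / lattice argument (Wiles, Urban,
Skinner–Urban, Wan: Fitting/length control along the whole Eisenstein component) delivers.  On the square rows ((SQ) `Ch·R₀⟦T⟧ = (F₁²)`,
(AN) `L = u·3ᵇ·L₁²`) this node proves, in the factorial ring `R₀⟦T⟧` (Auslander–Buchsbaum), that P1 is EXACTLY
   (RE)  EXISTENCE at every zero: every prime `q ∤ 3` with `q ∣ L₁` divides `F₁` — at each zero of `𝓛_𝔭` in the open disc the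
         localisation `X_(∅,0),𝔮 ≠ 0` (ONE Selmer class from ONE analytic zero; pointwise), plus
   (MZ)  MULTIPLICITY at the MULTIPLE zeros only: for primes `q ∤ 3` with `q² ∣ L₁`, `qᵐ ∣ L₁ ⟹ qᵐ ∣ F₁`,
(both WEAKER than P1: `rootwiseEisenstein_of_eisensteinRationalInclusion`, `multipleZeroMultiplicity_of_eisensteinRationalInclusion`;
jointly they give back P1 on rows with `L ≠ 0`: `eisensteinRationalInclusion_of_rootwise_of_multiple_ne_zero` — the analytic SQUARE doubles
every multiplicity for free, `ord_𝔮 F₁ ≥ 1 = ord_𝔮 L₁ ⟹ ord_𝔮 F₁² ≥ 2 = ord_𝔮 (L/3ᵇ)`), and that (MZ) is VACUOUS on every row whose `L₁` is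
squarefree away from `3` (`multipleZero_vacuous_of_squarefree`).  WHERE ARE THE MULTIPLE ZEROS?  At the trivial character the BDP-type
p-adic BSD conjecture [CHKLL23 = arXiv:2308.10474, Conj. 1.1(ii) p. 3] predicts `ord_T L = 2(max{r⁺,r⁻} − 1)` with `r± =` the signed
`ℤ_p`-ranks of `Š_p(E/K)`; here `r⁺ = rank Š_3(E/ℚ) = 1` (analytic rank 1 + Kolyvagin), so `ord_T L₁ = max{1,r⁻} − 1` and `T = 0` is a
MULTIPLE zero of `L₁` iff `r⁻ = rank Š_3(E^K/ℚ) ≥ 4` (expected; `r⁻ = 2` gives a SIMPLE zero, `r⁻ = 0` no zero); the same heuristic at a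
finite-order `χ` of `3`-power conductor needs a twist of signed Selmer rank `≥ 4` (finitely many candidate `χ` by Cornut–Vatsal);
NON-classical multiple zeros are conjecturally absent (generic simplicity).  [CHKLL23, Thm. 1.5(ii) p. 4] proves the ALGEBRAIC half
`ord_T F_BDP ≥ 2(max{r⁺,r⁻} − 1)` (good `p`; derived `p`-adic heights, Howard 2004) — the algebraic multiplicity GIVEN Selmer rank —
whereas (RE) at a classical zero asserts a Selmer class from ANALYTIC vanishing (Skinner–Urban 2006 / Bellaïche–Chenevier 2009 type:
«`L` vanishes ⟹ `Sel ≠ 0`», pointwise Ribet on a unitary eigenvariety) — the existence-grade E-side input of the rational road.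
So on rows without a signed-rank-≥ 4 twist in the `3`-tower and without a non-classical double zero, 24207 ⟸ (SQ)+(AN)+(RE)+P2, and (RE)
asks for ONE class at each of the finitely many (mostly non-classical) zeros `x ∈ V(𝓛_𝔭)`: a cuspidal–Eisenstein crossing of the
semi-ordinary U(3,1) Klingen–Eisenstein component `𝓔(f_E)` at `x` (constant term `∝ L₂(f_E/K)`; `f_E` supercuspidal at 3 is its own
`3`-stabilisation since `U₃ f_E = 0`), a Fourier–Jacobi coefficient of `𝓔` non-zero AT `x`, generic irreducibility on the cuspidal
component through `x`, Ribet/Bellaïche–Chenevier lattice at the point — NO Λ-adic Eisenstein ideal, NO Fitting/length control, NO Gorenstein.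
The Kolyvagin direction (every E-side supply format of g14/g24–g27: K2-rat, CFU, CFS, SQC, ANN, ONE, CLC) is not used on `E` at all.

PIECES AND TAGS (evidence):
* (SQ) `SquareCharGeneratorAtThree` — g14/g24/g25/g26/g27 VERBATIM. **WEAKER** (⟸ g24 (ELL): τ-twisted self-duality of the (∅,0)
  structure, Howard 2004 H.4) · leaf ATTACKABLE.
* (AN) `SquareRootLFunctionAtThree` — g24/g25 VERBATIM. **WEAKER** (true for the BDP square; `stub_toricFrameExistsOfBDP` of the LEAD line) ·
  leaf ATTACKABLE.
* (RE) `RootwiseEisensteinAtThree` — NEW. **WEAKER than P1** (kernel certificate) · **UNDECIDED** w.r.t. 24207 (Eisenstein direction; 24207 is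
  the Kolyvagin direction; implied by the rational IMC equality, so no cheap falsifier of truth) · leaf IDEA-NEEDED (engine E1⁺ above; in print
  only at CLASSICAL points and ordinary `p`: [SkinnerUrban2006 ICM «Vanishing of L-functions and ranks of Selmer groups»], [BellaicheChenevier2009
  Astérisque 324, sign −1 endoscopic points of U(3)]; the Λ-adic U(3,1) family for BDP is [Wan2020 ANT 14, doi:10.2140/ant.2020.14.383] (good
  ordinary), [arXiv:1412.1767 Castella–Wan] (good non-ordinary); N⁻ = 1 and a supercuspidal local datum at 3 in the pullback section are NOT
  in print — shared LOCAL research with SOED 20479 / g0 P1, but the GLOBAL part is pointwise, not Λ-adic).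
* (MZ) `MultipleZeroMultiplicityAtThree` — NEW. **WEAKER than P1** (kernel certificate) · **UNDECIDED** · **VACUOUS on simple-zero rows**
  (kernel) · leaf split: (i) non-classical multiple zeros — INSTRUMENTABLE (I-g28-1: Newton polygon + discriminant of the distinguished
  polynomial of `𝓛_𝔭 mod (3^M, T^M)` on O6 rows; kit 0 here); (ii) classical multiple zeros = rows with a signed-Selmer-rank-≥ 4 twist in the
  3-tower ([CHKLL23 Conj. 1.1(ii)]; INSTRUMENTABLE I-g28-2: `r_an(E^K) ≥ 4` or `L'(E/K,χ,1) = 0` for `cond χ | 27`) — there (MZ) is P1 LOCALISED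
  at finitely many classical points: IDEA-NEEDED (Λ-adic lattice at `x_χ` = g0/SOED lever localised) or BARRIER (the analytic order bound via
  maximal non-degeneracy of the anticyclotomic `p`-adic height [CHKLL23 p. 4; Bertolini–Darmon 1995 §3] — a Schneider-type hypothesis the
  UTD route is designed to avoid).
* P1 `EisensteinRationalInclusionAtThree`, P2 `CharLambdaDominanceAtThree` — g0 VERBATIM (P1 UNDECIDED·IDEA-NEEDED = SOED lever, here
  DERIVED from (SQ)+(AN)+(RE)+(MZ) under `L ≠ 0`; P2 WEAKER·ATTACKABLE per g0: 27120 σ-congruence ∧ Hsieh μ = 0 (20711) ∧ 24737 ∧ GV-λ ∧ twin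
  Kato degree frame).  g0's door P1 ∧ P2 ⟹ 24207 is copied VERBATIM (credit g0), re-cut to consume P1 only on rows with `L ≠ 0`.

DISPROOF USED: none relevant — no `Disproof.lean` / `TRIAGE-*` / `Negative/` exists for 24207 (crux dir listed 2026-08-31T22:3xZ);
`ledger negatives --problem BirchSwinnertonDyer` = {15532 `LeadingTermTamePinch`, 24881 `EquivariantChebotarevAtTwo`}, disjoint from this statement.
TYPING CHECKLIST 4c: no thresholds, no integrals, no determinantal gauge; (RE)/(MZ) carry the torsion and `L ≠ 0` guards (without the torsion
guard the junk `Ch = Λ` would make (RE) claim `𝓛_𝔭` has no zeros on non-torsion rows); `F₁ ≠ 0` is PROVED (`sq_generator_ne_zero`: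
`Ch ≠ ⊥` for any module, `Λ → R₀⟦T⟧` injective), so (RE)/(MZ) are not vacuous through `F₁ = 0`.

INSTRUMENT DATA: none run (kit 0).  HONEST STATUS: (RE) is research (pointwise Eisenstein congruences at non-classical points, additive 3);
(MZ) is research on the (expectedly sparse) multiple-zero rows and vacuous elsewhere; nothing here proves BSD for any curve; no sorry, no new
axiom, no named fact consumed; the only analytic input about zeros is carried as hypotheses, never asserted.
-/

set_option autoImplicit false
set_option linter.dupNamespace false

noncomputable section

open scoped Classical

namespace Summit.BirchSwinnertonDyer.BirchSwinnertonDyer.Cruxes.RationalSplitIMCInclusionAtThree.RootwiseEisensteinSimpleZeros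

open PowerSeries Literature.NumberTheory.EllipticCurves Literature.NumberTheory.EllipticCurves.KellerYin2024
  Literature.NumberTheory.GaloisRepresentations
  Summit.BirchSwinnertonDyer.Rank1Residual.X11b
  Summit.BirchSwinnertonDyer.BirchSwinnertonDyer.Theorems.SchneiderFreeAdditiveX3.KYBranchHalves

/-! ## §0  Vocabulary copied VERBATIM (modules of g0/g26/g27 nodes are workfiles, not importable): `IsSquarefreeUpTo` (g26; used only to state
the vacuity of (MZ) on simple-zero rows), (SQ), (AN) (g14/g24), P1, P2 (g0). Credit: those seats. -/

/-- `h` is SQUAREFREE AWAY FROM `c`: every square divisor of `h` divides a power of `c` (g26 verbatim). -/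
def IsSquarefreeUpTo {S : Type*} [CommRing S] (c h : S) : Prop :=
  ∀ x : S, x * x ∣ h → ∃ a : ℕ, x ∣ c ^ a

/-- `IsSquarefreeUpToThree h := IsSquarefreeUpTo 3 h` in `R₀⟦T⟧` (g26 verbatim). -/
def IsSquarefreeUpToThree (h : Literature.NumberTheory.EllipticCurves.UnrSeries 3) : Prop :=
  IsSquarefreeUpTo ((3 : ℕ) : Literature.NumberTheory.EllipticCurves.UnrSeries 3) h

/-- **(SQ) — g14/g24/g25/g26/g27's `SquareCharGeneratorAtThree` VERBATIM [WEAKER (⟸ g24 (ELL)) · leaf ATTACKABLE]** `Ch_Λ(X_(∅,0))·R₀⟦T⟧ = (F₁²)`. -/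
def SquareCharGeneratorAtThree : Prop :=
  ∀ (W : WeierstrassCurve ℚ) [W.IsElliptic] [W.IsGloballyMinimal] (N : ℕ) [NeZero N] (K : Type) [Field K] [NumberField K] (Dt : Literature.NumberTheory.EllipticCurves.ModularForms.ModularParametrizationData W N), Summit.BirchSwinnertonDyer.Rank1Residual.Additive.ClassO6 W 3 → W.HasSurjectiveModNGaloisRep 3 → W.analyticRank = 1 → W.conductorNorm ℤ = N → Literature.NumberTheory.EllipticCurves.IsImaginaryQuadratic K → Literature.NumberTheory.EllipticCurves.SatisfiesHeegnerHypothesis N K → ∀ (κ : Literature.NumberTheory.EllipticCurves.ZpExtension K 3), κ.IsAnticyclotomic → ∀ (γ : Field.absoluteGaloisGroup K) [Fact (κ.IsTopGenerator γ)] (𝔭 : IsDedekindDomain.HeightOneSpectrum (NumberField.RingOfIntegers K)), ((3 : ℕ) : NumberField.RingOfIntegers K) ∈ 𝔭.asIdeal → 𝔭.asIdeal.ramificationIdx (NumberField.RingOfIntegers ℚ) = 1 → 𝔭.asIdeal.inertiaDeg (NumberField.RingOfIntegers ℚ) = 1 → ∀ (𝔭' : IsDedekindDomain.HeightOneSpectrum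 (NumberField.RingOfIntegers K)), ((3 : ℕ) : NumberField.RingOfIntegers K) ∈ 𝔭'.asIdeal → 𝔭' ≠ 𝔭 → ∀ (ι' : PadicAlgCl 3 ≃+* ℂ), Summit.BirchSwinnertonDyer.BirchSwinnertonDyer.Theorems.SchneiderFree.BranchInducesPrime 3 ι' 𝔭 → ∀ (ΩK : ℂ) (Ωp : ℂ_[3]) (L : Literature.NumberTheory.EllipticCurves.UnrSeries 3), ΩK ≠ 0 → Ωp ≠ 0 → Literature.NumberTheory.EllipticCurves.IsBDPLFunction ι' 𝔭 κ γ Dt.f ΩK Ωp L → Module.IsTorsion (Literature.NumberTheory.EllipticCurves.IwasawaAlgebra 3) (Summit.BirchSwinnertonDyer.Rank1Residual.X11b.AcSelmer.XAc (W.baseChange K) 3 κ 𝔭' ∅ γ) →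
    ∃ F₁ : Literature.NumberTheory.EllipticCurves.UnrSeries 3,
      (Summit.BirchSwinnertonDyer.Rank1Residual.X11b.AcSelmer.XAc.charIdeal (W.baseChange K) 3 κ 𝔭' ∅ γ).map (PowerSeries.map (Summit.BirchSwinnertonDyer.Rank1Residual.X11b.Halves.toUnr 3)) = Ideal.span {F₁ ^ 2}

/-- **(AN) — g24/g25's `SquareRootLFunctionAtThree` VERBATIM [WEAKER — true for the BDP square · leaf ATTACKABLE]** `L = u·3^b·L₁²`. -/
def SquareRootLFunctionAtThree : Prop :=
  ∀ (W : WeierstrassCurve ℚ) [W.IsElliptic] [W.IsGloballyMinimal] (N : ℕ) [NeZero N] (K : Type) [Field K] [NumberField K] (Dt : Literature.NumberTheory.EllipticCurves.ModularForms.ModularParametrizationData W N), Summit.BirchSwinnertonDyer.Rank1Residual.Additive.ClassO6 W 3 → W.HasSurjectiveModNGaloisRep 3 → W.analyticRank = 1 → W.conductorNorm ℤ = N → Literature.NumberTheory.EllipticCurves.IsImaginaryQuadratic K → Literature.NumberTheory.EllipticCurves.SatisfiesHeegnerHypothesis N K → ∀ (κ : Literature.NumberTheory.EllipticCurves.ZpExtension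 K 3), κ.IsAnticyclotomic → ∀ (γ : Field.absoluteGaloisGroup K) [Fact (κ.IsTopGenerator γ)] (𝔭 : IsDedekindDomain.HeightOneSpectrum (NumberField.RingOfIntegers K)), ((3 : ℕ) : NumberField.RingOfIntegers K) ∈ 𝔭.asIdeal → 𝔭.asIdeal.ramificationIdx (NumberField.RingOfIntegers ℚ) = 1 → 𝔭.asIdeal.inertiaDeg (NumberField.RingOfIntegers ℚ) = 1 → ∀ (𝔭' : IsDedekindDomain.HeightOneSpectrum (NumberField.RingOfIntegers K)), ((3 : ℕ) : NumberField.RingOfIntegers K) ∈ 𝔭'.asIdeal → 𝔭' ≠ 𝔭 → ∀ (ι' : PadicAlgCl 3 ≃+* ℂ), Summit.BirchSwinnertonDyer.BirchSwinnertonDyer.Theorems.SchneiderFree.BranchInducesPrime 3 ι' 𝔭 → ∀ (ΩK : ℂ) (Ωp : ℂ_[3]) (L : Literature.NumberTheory.EllipticCurves.UnrSeries 3), ΩK ≠ 0 → Ωp ≠ 0 → Literature.NumberTheory.EllipticCurves.IsBDPLFunction ι' 𝔭 κ γ Dt.f ΩK Ωp L → Module.IsTorsion (Literature.NumberTheory.EllipticCurves.IwasawaAlgebra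 3) (Summit.BirchSwinnertonDyer.Rank1Residual.X11b.AcSelmer.XAc (W.baseChange K) 3 κ 𝔭' ∅ γ) →
    ∃ (L₁ u : Literature.NumberTheory.EllipticCurves.UnrSeries 3) (b : ℕ), IsUnit u ∧
      L = u * ((3 : ℕ) : Literature.NumberTheory.EllipticCurves.UnrSeries 3) ^ b * L₁ ^ 2

/-- **P1 — g0's `EisensteinRationalInclusionAtThree` VERBATIM [UNDECIDED · leaf IDEA-NEEDED, shared with SOED 20479; DERIVED in this
node (under `L ≠ 0`) from (SQ)+(AN)+(RE)+(MZ)]** `∃ k, 3^k · Ch_Λ(X_(∅,0))·R₀⟦T⟧ ⊆ (L)`. -/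
def EisensteinRationalInclusionAtThree : Prop :=
  ∀ (W : WeierstrassCurve ℚ) [W.IsElliptic] [W.IsGloballyMinimal] (N : ℕ) [NeZero N] (K : Type) [Field K] [NumberField K] (Dt : Literature.NumberTheory.EllipticCurves.ModularForms.ModularParametrizationData W N), Summit.BirchSwinnertonDyer.Rank1Residual.Additive.ClassO6 W 3 → W.HasSurjectiveModNGaloisRep 3 → W.analyticRank = 1 → W.conductorNorm ℤ = N → Literature.NumberTheory.EllipticCurves.IsImaginaryQuadratic K → Literature.NumberTheory.EllipticCurves.SatisfiesHeegnerHypothesis N K → ∀ (κ : Literature.NumberTheory.EllipticCurves.ZpExtension K 3), κ.IsAnticyclotomic → ∀ (γ : Field.absoluteGaloisGroup K) [Fact (κ.IsTopGenerator γ)] (𝔭 : IsDedekindDomain.HeightOneSpectrum (NumberField.RingOfIntegers K)), ((3 : ℕ) : NumberField.RingOfIntegers K) ∈ 𝔭.asIdeal → 𝔭.asIdeal.ramificationIdx (NumberField.RingOfIntegers ℚ) = 1 → 𝔭.asIdeal.inertiaDeg (NumberField.RingOfIntegers ℚ) = 1 → ∀ (𝔭' : IsDedekindDomain.HeightOneSpectrum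 (NumberField.RingOfIntegers K)), ((3 : ℕ) : NumberField.RingOfIntegers K) ∈ 𝔭'.asIdeal → 𝔭' ≠ 𝔭 → ∀ (ι' : PadicAlgCl 3 ≃+* ℂ), Summit.BirchSwinnertonDyer.BirchSwinnertonDyer.Theorems.SchneiderFree.BranchInducesPrime 3 ι' 𝔭 → ∀ (ΩK : ℂ) (Ωp : ℂ_[3]) (L : Literature.NumberTheory.EllipticCurves.UnrSeries 3), ΩK ≠ 0 → Ωp ≠ 0 → Literature.NumberTheory.EllipticCurves.IsBDPLFunction ι' 𝔭 κ γ Dt.f ΩK Ωp L → Module.IsTorsion (Literature.NumberTheory.EllipticCurves.IwasawaAlgebra 3) (Summit.BirchSwinnertonDyer.Rank1Residual.X11b.AcSelmer.XAc (W.baseChange K) 3 κ 𝔭' ∅ γ) → ∃ k : ℕ, ∀ x ∈ ((Summit.BirchSwinnertonDyer.Rank1Residual.X11b.AcSelmer.XAc.charIdeal (W.baseChange K) 3 κ 𝔭' ∅ γ).map (PowerSeries.map (Summit.BirchSwinnertonDyer.Rank1Residual.X11b.Halves.toUnr 3))), (3 : Literature.NumberTheory.EllipticCurves.UnrSeries 3)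 ^ k * x ∈ Ideal.span {L}

/-- **P2 — g0's `CharLambdaDominanceAtThree` VERBATIM [WEAKER · leaf ATTACKABLE]** one-sided degree dominance `λ(Ch X_(∅,0)(E)) ≤ λ(L)`. -/
def CharLambdaDominanceAtThree : Prop :=
  ∀ (W : WeierstrassCurve ℚ) [W.IsElliptic] [W.IsGloballyMinimal] (N : ℕ) [NeZero N] (K : Type) [Field K] [NumberField K] (Dt : Literature.NumberTheory.EllipticCurves.ModularForms.ModularParametrizationData W N), Summit.BirchSwinnertonDyer.Rank1Residual.Additive.ClassO6 W 3 → W.HasSurjectiveModNGaloisRep 3 → W.analyticRank = 1 → W.conductorNorm ℤ = N → Literature.NumberTheory.EllipticCurves.IsImaginaryQuadratic K → Literature.NumberTheory.EllipticCurves.SatisfiesHeegnerHypothesis N K → ∀ (κ : Literature.NumberTheory.EllipticCurves.ZpExtension K 3), κ.IsAnticyclotomic → ∀ (γ : Field.absoluteGaloisGroup K) [Fact (κ.IsTopGenerator γ)] (𝔭 : IsDedekindDomain.HeightOneSpectrum (NumberField.RingOfIntegers K)), ((3 : ℕ) : NumberField.RingOfIntegers K) ∈ 𝔭.asIdeal →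 𝔭.asIdeal.ramificationIdx (NumberField.RingOfIntegers ℚ) = 1 → 𝔭.asIdeal.inertiaDeg (NumberField.RingOfIntegers ℚ) = 1 → ∀ (𝔭' : IsDedekindDomain.HeightOneSpectrum (NumberField.RingOfIntegers K)), ((3 : ℕ) : NumberField.RingOfIntegers K) ∈ 𝔭'.asIdeal → 𝔭' ≠ 𝔭 → ∀ (ι' : PadicAlgCl 3 ≃+* ℂ), Summit.BirchSwinnertonDyer.BirchSwinnertonDyer.Theorems.SchneiderFree.BranchInducesPrime 3 ι' 𝔭 → ∀ (ΩK : ℂ) (Ωp : ℂ_[3]) (L : Literature.NumberTheory.EllipticCurves.UnrSeries 3), ΩK ≠ 0 → Ωp ≠ 0 → Literature.NumberTheory.EllipticCurves.IsBDPLFunction ι' 𝔭 κ γ Dt.f ΩK Ωp L → Module.IsTorsion (Literature.NumberTheory.EllipticCurves.IwasawaAlgebra 3) (Summit.BirchSwinnertonDyer.Rank1Residual.X11b.AcSelmer.XAc (W.baseChange K) 3 κ 𝔭' ∅ γ) → L ≠ 0 → ∃ (F F₀ L₀ : Literature.NumberTheory.EllipticCurves.UnrSeries 3) (a m c n : ℕ),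 (Summit.BirchSwinnertonDyer.Rank1Residual.X11b.AcSelmer.XAc.charIdeal (W.baseChange K) 3 κ 𝔭' ∅ γ).map (PowerSeries.map (Summit.BirchSwinnertonDyer.Rank1Residual.X11b.Halves.toUnr 3)) = Ideal.span {F} ∧ F = PowerSeries.C (((3 : ℕ) : Literature.NumberTheory.EllipticCurves.unrIntegers 3) ^ a) * F₀ ∧ Literature.NumberTheory.EllipticCurves.KellerYin2024.FirstUnitCoeffAt F₀ m ∧ L = PowerSeries.C (((3 : ℕ) : Literature.NumberTheory.EllipticCurves.unrIntegers 3) ^ c) * L₀ ∧ Literature.NumberTheory.EllipticCurves.KellerYin2024.FirstUnitCoeffAt L₀ n ∧ m ≤ n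

/-! ## §A  The two NEW pieces: g0's P1 split into EXISTENCE at every zero (RE) and MULTIPLICITY at the multiple zeros only (MZ) -/

/-- **(RE) ROOTWISE EISENSTEIN EXISTENCE [NEW · WEAKER than P1 (`rootwiseEisenstein_of_eisensteinRationalInclusion`) · UNDECIDED w.r.t.
24207 (Eisenstein direction; 24207 is the Kolyvagin direction) · leaf IDEA-NEEDED (engine E1⁺: Bellaïche–Chenevier pointwise Ribet on the
U(3,1) eigenvariety at each point `x ∈ V(𝓛_𝔭)` of the anticyclotomic line of the semi-ordinary Klingen–Eisenstein component `𝓔(f_E)` —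
`f_E` supercuspidal at 3 is its own `3`-stabilisation since `U₃ f_E = 0`; needs (FJ_x) a Fourier–Jacobi coefficient of `𝓔` non-zero at `x`,
generic irreducibility on the cuspidal component through `x`, and the semi-ordinary triangulation at `x` to land the class in the (∅,0)
condition; NO Λ-adic lattice, NO Fitting/length control, NO Gorenstein)]**: under 24207's binders, on a torsion row with `L ≠ 0`, for
every square generator `F₁` of `Ch_Λ(X_(∅,0))·R₀⟦T⟧` and every square root `L₁` of `L`: every prime `q ∤ 3` of `R₀⟦T⟧` dividing `L₁`
divides `F₁` — at every zero of `𝓛_𝔭` in the open disc the localisation `X_(∅,0),𝔮` is non-zero (ONE Selmer class; no multiplicity). -/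
def RootwiseEisensteinAtThree : Prop :=
  ∀ (W : WeierstrassCurve ℚ) [W.IsElliptic] [W.IsGloballyMinimal] (N : ℕ) [NeZero N] (K : Type) [Field K] [NumberField K] (Dt : Literature.NumberTheory.EllipticCurves.ModularForms.ModularParametrizationData W N), Summit.BirchSwinnertonDyer.Rank1Residual.Additive.ClassO6 W 3 → W.HasSurjectiveModNGaloisRep 3 → W.analyticRank = 1 → W.conductorNorm ℤ = N → Literature.NumberTheory.EllipticCurves.IsImaginaryQuadratic K → Literature.NumberTheory.EllipticCurves.SatisfiesHeegnerHypothesis N K → ∀ (κ : Literature.NumberTheory.EllipticCurves.ZpExtension K 3), κ.IsAnticyclotomic → ∀ (γ : Field.absoluteGaloisGroup K) [Fact (κ.IsTopGenerator γ)] (𝔭 : IsDedekindDomain.HeightOneSpectrum (NumberField.RingOfIntegers K)), ((3 : ℕ) : NumberField.RingOfIntegers K) ∈ 𝔭.asIdeal → 𝔭.asIdeal.ramificationIdx (NumberField.RingOfIntegers ℚ) = 1 → 𝔭.asIdeal.inertiaDeg (NumberField.RingOfIntegers ℚ) = 1 → ∀ (𝔭' : IsDedekindDomain.HeightOneSpectrum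 (NumberField.RingOfIntegers K)), ((3 : ℕ) : NumberField.RingOfIntegers K) ∈ 𝔭'.asIdeal → 𝔭' ≠ 𝔭 → ∀ (ι' : PadicAlgCl 3 ≃+* ℂ), Summit.BirchSwinnertonDyer.BirchSwinnertonDyer.Theorems.SchneiderFree.BranchInducesPrime 3 ι' 𝔭 → ∀ (ΩK : ℂ) (Ωp : ℂ_[3]) (L : Literature.NumberTheory.EllipticCurves.UnrSeries 3), ΩK ≠ 0 → Ωp ≠ 0 → Literature.NumberTheory.EllipticCurves.IsBDPLFunction ι' 𝔭 κ γ Dt.f ΩK Ωp L → Module.IsTorsion (Literature.NumberTheory.EllipticCurves.IwasawaAlgebra 3) (Summit.BirchSwinnertonDyer.Rank1Residual.X11b.AcSelmer.XAc (W.baseChange K) 3 κ 𝔭' ∅ γ) → L ≠ 0 →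
    ∀ (F₁ L₁ u : Literature.NumberTheory.EllipticCurves.UnrSeries 3) (b : ℕ),
      (Summit.BirchSwinnertonDyer.Rank1Residual.X11b.AcSelmer.XAc.charIdeal (W.baseChange K) 3 κ 𝔭' ∅ γ).map (PowerSeries.map (Summit.BirchSwinnertonDyer.Rank1Residual.X11b.Halves.toUnr 3)) = Ideal.span {F₁ ^ 2} →
      IsUnit u → L = u * ((3 : ℕ) : Literature.NumberTheory.EllipticCurves.UnrSeries 3) ^ b * L₁ ^ 2 →
      ∀ q : Literature.NumberTheory.EllipticCurves.UnrSeries 3, Prime q →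
        ¬ q ∣ ((3 : ℕ) : Literature.NumberTheory.EllipticCurves.UnrSeries 3) → q ∣ L₁ → q ∣ F₁

/-- **(MZ) MULTIPLICITY AT THE MULTIPLE ZEROS ONLY [NEW · WEAKER than P1 (`multipleZeroMultiplicity_of_eisensteinRationalInclusion`) ·
UNDECIDED · VACUOUS on rows where `𝓛_𝔭` has simple zeros off `3` (`multipleZeroMultiplicity_vacuous_of_squarefree`) · leaf split:
(i) NON-CLASSICAL multiple zeros — conjecturally none (generic simplicity), INSTRUMENTABLE (I-g28-1: Newton polygon + discriminant of the
distinguished polynomial of `𝓛_𝔭 mod (3^M, T^M)` on O6 rows); (ii) CLASSICAL exceptional zeros `x_χ` (finite-order `χ` of `3`-power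
conductor with `P_χ` torsion, i.e. `r_an(E/K, χ) ≥ 3` — finitely many by Cornut–Vatsal; `χ = 1` occurs iff `r_an(E^K/ℚ) ≥ 2`, so such rows
EXIST): there `ord 𝓛_𝔭 = r − 1 ≥ 2` is expected (anticyclotomic p-adic BSD of Bertolini–Darmon / Agboola–Castella type) and (MZ) is the
Λ-adic length problem `length X_(∅,0),𝔮 ≥ ord_𝔮 𝓛_𝔭` at finitely many points = g0's P1 LOCALISED (derived p-adic heights, Howard 2004) —
IDEA-NEEDED]**: under 24207's binders, on a torsion row with `L ≠ 0`, for every prime `q ∤ 3` with `q² ∣ L₁`: `qᵐ ∣ L₁ ⟹ qᵐ ∣ F₁`. -/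
def MultipleZeroMultiplicityAtThree : Prop :=
  ∀ (W : WeierstrassCurve ℚ) [W.IsElliptic] [W.IsGloballyMinimal] (N : ℕ) [NeZero N] (K : Type) [Field K] [NumberField K] (Dt : Literature.NumberTheory.EllipticCurves.ModularForms.ModularParametrizationData W N), Summit.BirchSwinnertonDyer.Rank1Residual.Additive.ClassO6 W 3 → W.HasSurjectiveModNGaloisRep 3 → W.analyticRank = 1 → W.conductorNorm ℤ = N → Literature.NumberTheory.EllipticCurves.IsImaginaryQuadratic K → Literature.NumberTheory.EllipticCurves.SatisfiesHeegnerHypothesis N K → ∀ (κ : Literature.NumberTheory.EllipticCurves.ZpExtension K 3), κ.IsAnticyclotomic → ∀ (γ : Field.absoluteGaloisGroup K) [Fact (κ.IsTopGenerator γ)] (𝔭 : IsDedekindDomain.HeightOneSpectrum (NumberField.RingOfIntegers K)), ((3 : ℕ) : NumberField.RingOfIntegers K) ∈ 𝔭.asIdeal → 𝔭.asIdeal.ramificationIdx (NumberField.RingOfIntegers ℚ) = 1 → 𝔭.asIdeal.inertiaDeg (NumberField.RingOfIntegers ℚ) = 1 → ∀ (𝔭' : IsDedekindDomain.HeightOneSpectrum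 (NumberField.RingOfIntegers K)), ((3 : ℕ) : NumberField.RingOfIntegers K) ∈ 𝔭'.asIdeal → 𝔭' ≠ 𝔭 → ∀ (ι' : PadicAlgCl 3 ≃+* ℂ), Summit.BirchSwinnertonDyer.BirchSwinnertonDyer.Theorems.SchneiderFree.BranchInducesPrime 3 ι' 𝔭 → ∀ (ΩK : ℂ) (Ωp : ℂ_[3]) (L : Literature.NumberTheory.EllipticCurves.UnrSeries 3), ΩK ≠ 0 → Ωp ≠ 0 → Literature.NumberTheory.EllipticCurves.IsBDPLFunction ι' 𝔭 κ γ Dt.f ΩK Ωp L → Module.IsTorsion (Literature.NumberTheory.EllipticCurves.IwasawaAlgebra 3) (Summit.BirchSwinnertonDyer.Rank1Residual.X11b.AcSelmer.XAc (W.baseChange K) 3 κ 𝔭' ∅ γ) → L ≠ 0 →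
    ∀ (F₁ L₁ u : Literature.NumberTheory.EllipticCurves.UnrSeries 3) (b : ℕ),
      (Summit.BirchSwinnertonDyer.Rank1Residual.X11b.AcSelmer.XAc.charIdeal (W.baseChange K) 3 κ 𝔭' ∅ γ).map (PowerSeries.map (Summit.BirchSwinnertonDyer.Rank1Residual.X11b.Halves.toUnr 3)) = Ideal.span {F₁ ^ 2} →
      IsUnit u → L = u * ((3 : ℕ) : Literature.NumberTheory.EllipticCurves.UnrSeries 3) ^ b * L₁ ^ 2 →
      ∀ (q : Literature.NumberTheory.EllipticCurves.UnrSeries 3) (m : ℕ), Prime q →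
        ¬ q ∣ ((3 : ℕ) : Literature.NumberTheory.EllipticCurves.UnrSeries 3) → q * q ∣ L₁ → q ^ m ∣ L₁ → q ^ m ∣ F₁

/-! ## §B  The algebra (any factorial domain): «every prime of `h` off `c` divides `M`» + «full multiplicity at the repeated primes» ⟹ `h ∣ cᵏ·M` -/

open UniqueFactorizationMonoid in
/-- In a factorial domain: `a` irreducible, `M ≠ 0`: `aᵐ ∣ M ↔ m ≤ #ₐ(M)` (count of `normalize a` among the normalised factors). [Mathlib glue] -/
theorem pow_dvd_iff_le_count {S : Type*} [CommRing S] [IsDomain S] [UniqueFactorizationMonoid S] [NormalizationMonoid S]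
    {a M : S} (ha : Irreducible a) (hM : M ≠ 0) (m : ℕ) :
    a ^ m ∣ M ↔ m ≤ Multiset.count (normalize a) (normalizedFactors M) := by
  rw [pow_dvd_iff_le_emultiplicity, emultiplicity_eq_count_normalizedFactors ha hM]
  exact Nat.cast_le

open UniqueFactorizationMonoid in
/-- **Existence + multiplicity-at-repeated-primes ⟹ divisibility up to `c` (any factorial domain).** `c` prime, `h, M ≠ 0`; if every prime
`q ∤ c` dividing `h` divides `M`, and every prime `q ∤ c` with `q² ∣ h` satisfies `qᵐ ∣ h ⟹ qᵐ ∣ M`, then `h ∣ cᵏ·M` with `k = v_c(h)`. [folklore] -/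
theorem dvd_pow_mul_of_rootwise_of_multiple {S : Type*} [CommRing S] [IsDomain S] [UniqueFactorizationMonoid S]
    {c : S} (hc : Prime c) (h M : S) (hh : h ≠ 0) (hM : M ≠ 0)
    (hroot : ∀ q : S, Prime q → ¬ q ∣ c → q ∣ h → q ∣ M)
    (hmult : ∀ (q : S) (m : ℕ), Prime q → ¬ q ∣ c → q * q ∣ h → q ^ m ∣ h → q ^ m ∣ M) :
    ∃ k : ℕ, h ∣ c ^ k * M := by
  letI : StrongNormalizationMonoid S := UniqueFactorizationMonoid.strongNormalizationMonoid
  refine ⟨Multiset.count (normalize c) (normalizedFactors h), ?_⟩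
  have hcM : c ^ (Multiset.count (normalize c) (normalizedFactors h)) * M ≠ 0 :=
    mul_ne_zero (pow_ne_zero _ hc.ne_zero) hM
  rw [dvd_iff_normalizedFactors_le_normalizedFactors hh hcM, normalizedFactors_mul (pow_ne_zero _ hc.ne_zero) hM,
    normalizedFactors_pow, normalizedFactors_irreducible hc.irreducible, Multiset.le_iff_count]
  intro a
  simp only [Multiset.count_add, Multiset.count_nsmul, Multiset.count_singleton]
  by_cases han : a = normalize c
  · subst han
    simp only [if_true]
    omega
  · simp only [han, if_false, mul_zero, zero_add]
    -- `m := #ₐ(h)`; if `m = 0` done; else `a` is a normalised prime factor of `h`, `a ∤ c`, `aᵐ ∣ h`, and (hroot/hmult) `aᵐ ∣ M`.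
    by_cases h0 : Multiset.count a (normalizedFactors h) = 0
    · omega
    have hamem : a ∈ normalizedFactors h := Multiset.count_pos.mp (by omega)
    have hairr : Irreducible a := irreducible_of_normalized_factor a hamem
    have haprime : Prime a := prime_of_normalized_factor a hamem
    have han' : normalize a = a := normalize_normalized_factor a hamem
    have hac : ¬ a ∣ c := by
      intro hdvd
      have hassoc : Associated c a := (hc.irreducible.dvd_iff.mp hdvd).resolve_left hairr.not_isUnit
      exact han (by rw [← han']; exact normalize_eq_normalize hdvd hassoc.dvd)
    have hpow : a ^ (Multiset.count a (normalizedFactors h)) ∣ h := by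
      rw [pow_dvd_iff_le_count hairr hh, han']
    have hpowM : a ^ (Multiset.count a (normalizedFactors h)) ∣ M := by
      by_cases h1 : Multiset.count a (normalizedFactors h) = 1
      · rw [h1, pow_one] at hpow ⊢
        exact hroot a haprime hac hpow
      · have h2 : 2 ≤ Multiset.count a (normalizedFactors h) := by omega
        have haa : a * a ∣ h := by
          rw [← pow_two]; exact (pow_dvd_pow a h2).trans hpow
        exact hmult a _ haprime hac haa hpow
    have := (pow_dvd_iff_le_count hairr hM _).mp hpowM
    rw [han'] at this
    exact this

/-- `R₀⟦T⟧ = W(𝔽̄₃)⟦T⟧` (`UnrSeries 3`) is factorial (regular local of dimension 2; Auslander–Buchsbaum) — g27's proof verbatim.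
[cite: Matsumura1987, Thm. 19.5, Thm. 20.3] -/
theorem uniqueFactorizationMonoid_unrSeries : UniqueFactorizationMonoid (UnrSeries 3) := by
  haveI := Summit.BirchSwinnertonDyer.Rank1Residual.X2.HidaLimitAlgebra.isDiscreteValuationRing_unrIntegers (p := 3)
  haveI := NearlyOrdinaryPresentationCA.isRegularLocalRing_mvPowerSeries_dvr (unrIntegers 3) 1
  exact Literature.AlgebraicGeometry.Resolution.uniqueFactorizationMonoid_of_isRegularLocalRing _
    (IsRegularLocalRing.of_ringEquiv (MvPowerSeries.renameEquiv (unrIntegers 3) finOneEquiv.symm).toRingEquiv.symm)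

/-- `3` is prime in `R₀⟦T⟧`. -/
theorem prime_three_unrSeries : Prime (((3 : ℕ) : UnrSeries 3)) := by
  have heq : ((3 : ℕ) : UnrSeries 3) = PowerSeries.C (((3 : ℕ) : unrIntegers 3)) := by rw [map_natCast]
  rw [heq]
  haveI := Summit.BirchSwinnertonDyer.Rank1Residual.X2.HidaLimitAlgebra.isDiscreteValuationRing_unrIntegers (p := 3)
  exact Literature.NumberTheory.EllipticCurves.prime_C_of_prime
    (Summit.BirchSwinnertonDyer.Rank1Residual.X2.HidaLimitAlgebra.irreducible_natCast_p (p := 3)).prime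

/-- `Ch_Λ(X)·R₀⟦T⟧ ≠ 0` for ANY `Λ`-module `X` (a characteristic ideal is a finite product of powers of height-one primes, or the junk `1`;
`Λ → R₀⟦T⟧` is injective).  Hence a square generator `F₁` is non-zero. -/
theorem sq_generator_ne_zero {X : Type*} [AddCommGroup X] [Module (IwasawaAlgebra 3) X] {F₁ : UnrSeries 3}
    (hCh : (Literature.NumberTheory.EllipticCurves.Module.charIdeal (IwasawaAlgebra 3) X).map (PowerSeries.map (Halves.toUnr 3))
      = Ideal.span {F₁ ^ 2}) : F₁ ≠ 0 := by
  intro hF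
  rw [hF, zero_pow two_ne_zero, Ideal.span_singleton_eq_bot.mpr rfl,
    Ideal.map_eq_bot_iff_of_injective (Summit.BirchSwinnertonDyer.Rank1Residual.X11b.map_toUnr_injective (p := 3))] at hCh
  exact Literature.NumberTheory.EllipticCurves.Module.charIdeal_ne_bot (IwasawaAlgebra 3) X hCh

/-- **On a row whose `L₁` is squarefree away from `3` (simple zeros of `𝓛_𝔭`), (MZ)'s conclusion is VACUOUS**: no prime `q ∤ 3` has `q² ∣ L₁`. -/
theorem multipleZero_vacuous_of_squarefree (L₁ F₁ : UnrSeries 3) (hsq : IsSquarefreeUpToThree L₁)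
    (q : UnrSeries 3) (m : ℕ) (hq : Prime q) (hq3 : ¬ q ∣ ((3 : ℕ) : UnrSeries 3)) (hqq : q * q ∣ L₁) (_hm : q ^ m ∣ L₁) :
    q ^ m ∣ F₁ := by
  obtain ⟨a, ha⟩ := hsq q hqq
  exact absurd (hq.dvd_of_dvd_pow ha) hq3

/-! ## §C  (SQ) ∧ (AN) ∧ (RE) ∧ (MZ) ⟹ P1 (the Eisenstein inclusion WITH multiplicity, guarded by `L ≠ 0`) — and the WEAKER certificates -/

/-- **Existence at every zero + multiplicity at the multiple zeros + squares ⟹ g0's P1 (under `L ≠ 0`).**  On a torsion row with `L ≠ 0`: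
`Ch·R₀⟦T⟧ = (F₁²)` (so `F₁ ≠ 0`), `L = u·3ᵇ·L₁²`; §B gives `L₁ ∣ 3ᵏ·F₁`, hence `L ∣ u·3ᵇ⁺²ᵏ·F₁²`, i.e. `3^(b+2k)·x ∈ (L)` for every
`x ∈ (F₁²)`.  (g0's door consumes P1 only on rows with `L ≠ 0`; `L = 0` rows satisfy 24207 with `k = 0`.) -/
theorem eisensteinRationalInclusion_of_rootwise_of_multiple_ne_zero
    (hSQ : SquareCharGeneratorAtThree) (hAN : SquareRootLFunctionAtThree)
    (hRE : RootwiseEisensteinAtThree) (hMZ : MultipleZeroMultiplicityAtThree) :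
    ∀ (W : WeierstrassCurve ℚ) [W.IsElliptic] [W.IsGloballyMinimal] (N : ℕ) [NeZero N] (K : Type) [Field K] [NumberField K] (Dt : Literature.NumberTheory.EllipticCurves.ModularForms.ModularParametrizationData W N), Summit.BirchSwinnertonDyer.Rank1Residual.Additive.ClassO6 W 3 → W.HasSurjectiveModNGaloisRep 3 → W.analyticRank = 1 → W.conductorNorm ℤ = N → Literature.NumberTheory.EllipticCurves.IsImaginaryQuadratic K → Literature.NumberTheory.EllipticCurves.SatisfiesHeegnerHypothesis N K → ∀ (κ : Literature.NumberTheory.EllipticCurves.ZpExtension K 3), κ.IsAnticyclotomic → ∀ (γ : Field.absoluteGaloisGroup K) [Fact (κ.IsTopGenerator γ)] (𝔭 : IsDedekindDomain.HeightOneSpectrum (NumberField.RingOfIntegers K)), ((3 : ℕ) : NumberField.RingOfIntegers K) ∈ 𝔭.asIdeal → 𝔭.asIdeal.ramificationIdx (NumberField.RingOfIntegers ℚ) = 1 → 𝔭.asIdeal.inertiaDeg (NumberField.RingOfIntegers ℚ) = 1 → ∀ (𝔭' : IsDedekindDomain.HeightOneSpectrum (NumberField.RingOfIntegers K)), ((3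 : ℕ) : NumberField.RingOfIntegers K) ∈ 𝔭'.asIdeal → 𝔭' ≠ 𝔭 → ∀ (ι' : PadicAlgCl 3 ≃+* ℂ), Summit.BirchSwinnertonDyer.BirchSwinnertonDyer.Theorems.SchneiderFree.BranchInducesPrime 3 ι' 𝔭 → ∀ (ΩK : ℂ) (Ωp : ℂ_[3]) (L : Literature.NumberTheory.EllipticCurves.UnrSeries 3), ΩK ≠ 0 → Ωp ≠ 0 → Literature.NumberTheory.EllipticCurves.IsBDPLFunction ι' 𝔭 κ γ Dt.f ΩK Ωp L → Module.IsTorsion (Literature.NumberTheory.EllipticCurves.IwasawaAlgebra 3) (Summit.BirchSwinnertonDyer.Rank1Residual.X11b.AcSelmer.XAc (W.baseChange K) 3 κ 𝔭' ∅ γ) → L ≠ 0 → ∃ k : ℕ, ∀ x ∈ ((Summit.BirchSwinnertonDyer.Rank1Residual.X11b.AcSelmer.XAc.charIdeal (W.baseChange K) 3 κ 𝔭' ∅ γ).map (PowerSeries.map (Summit.BirchSwinnertonDyer.Rank1Residual.X11b.Halves.toUnr 3))), (3 : Literature.NumberTheory.EllipticCurves.UnrSeries 3) ^ k * x ∈ Ideal.span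 {L} := by
  intro W _ _ N _ K _ _ Dt hO6 hsurj hr1 hN hK hH κ hκ γ _ 𝔭 h𝔭 he hf 𝔭' h𝔭' hne ι' hι ΩK Ωp L hΩK hΩp hL htor hL0
  obtain ⟨F₁, hCh⟩ := hSQ W N K Dt hO6 hsurj hr1 hN hK hH κ hκ γ 𝔭 h𝔭 he hf 𝔭' h𝔭' hne ι' hι ΩK Ωp L hΩK hΩp hL htor
  obtain ⟨L₁, u, b, hu, hLeq⟩ := hAN W N K Dt hO6 hsurj hr1 hN hK hH κ hκ γ 𝔭 h𝔭 he hf 𝔭' h𝔭' hne ι' hι ΩK Ωp L hΩK hΩp hL htor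
  have hF₁ : F₁ ≠ 0 := sq_generator_ne_zero hCh
  have hL₁ : L₁ ≠ 0 := by
    rintro rfl
    exact hL0 (by rw [hLeq, zero_pow two_ne_zero, mul_zero])
  have hroot := hRE W N K Dt hO6 hsurj hr1 hN hK hH κ hκ γ 𝔭 h𝔭 he hf 𝔭' h𝔭' hne ι' hι ΩK Ωp L hΩK hΩp hL htor hL0 F₁ L₁ u b hCh hu hLeq
  have hmult := hMZ W N K Dt hO6 hsurj hr1 hN hK hH κ hκ γ 𝔭 h𝔭 he hf 𝔭' h𝔭' hne ι' hι ΩK Ωp L hΩK hΩp hL htor hL0 F₁ L₁ u b hCh hu hLeq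
  haveI := uniqueFactorizationMonoid_unrSeries
  obtain ⟨c', hc'⟩ := dvd_pow_mul_of_rootwise_of_multiple prime_three_unrSeries L₁ F₁ hL₁ hF₁ hroot hmult
  -- `L₁ ∣ 3^{c'} F₁` ⟹ `L = u 3^b L₁² ∣ u · 3^{b + 2c'} F₁²`
  obtain ⟨q, hq⟩ := hc'
  refine ⟨b + 2 * c', ?_⟩
  intro x hx
  rw [hCh, Ideal.mem_span_singleton] at hx
  obtain ⟨y, hy⟩ := hx
  rw [Ideal.mem_span_singleton]
  have h3 : (3 : UnrSeries 3) = ((3 : ℕ) : UnrSeries 3) := by rw [Nat.cast_ofNat]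
  obtain ⟨v, hv⟩ := hu.exists_left_inv
  refine ⟨v * q ^ 2 * y, ?_⟩
  have key : ((3 : ℕ) : UnrSeries 3) ^ (b + 2 * c') * (F₁ ^ 2 * y)
      = (u * ((3 : ℕ) : UnrSeries 3) ^ b * L₁ ^ 2) * (v * q ^ 2 * y) := by
    have e1 : ((3 : ℕ) : UnrSeries 3) ^ (b + 2 * c') * (F₁ ^ 2 * y)
        = ((3 : ℕ) : UnrSeries 3) ^ b * (((3 : ℕ) : UnrSeries 3) ^ c' * F₁) ^ 2 * y := by ring
    rw [e1, hq]
    have e2 : (u * ((3 : ℕ) : UnrSeries 3) ^ b * L₁ ^ 2) * (v * q ^ 2 * y)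
        = (v * u) * (((3 : ℕ) : UnrSeries 3) ^ b * (L₁ * q) ^ 2 * y) := by ring
    rw [e2, hv, one_mul]
  rw [h3, hy, key, ← hLeq]

/-- From P1 on a row: `L₁ ∣ 3ᵏ · F₁²` (used by both WEAKER certificates). -/
theorem sqRoot_dvd_of_P1 {L L₁ u F₁ : UnrSeries 3} {b k : ℕ} (hLeq : L = u * ((3 : ℕ) : UnrSeries 3) ^ b * L₁ ^ 2)
    (h1 : (3 : UnrSeries 3) ^ k * F₁ ^ 2 ∈ Ideal.span ({L} : Set (UnrSeries 3))) :
    L₁ ∣ ((3 : ℕ) : UnrSeries 3) ^ k * F₁ ^ 2 := by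
  have hLL₁ : Ideal.span ({L} : Set (UnrSeries 3)) ≤ Ideal.span {L₁} := by
    rw [Ideal.span_singleton_le_span_singleton, hLeq]
    exact Dvd.intro_left (u * ((3 : ℕ) : UnrSeries 3) ^ b * L₁) (by ring)
  have h3 : ((3 : ℕ) : UnrSeries 3) = (3 : UnrSeries 3) := by rw [Nat.cast_ofNat]
  rw [h3, ← Ideal.mem_span_singleton]
  exact hLL₁ h1

/-- **WEAKER-certificate 1: P1 ⟹ (RE).** `q ∣ L₁ ∣ 3ᵏF₁²`, `q` prime, `q ∤ 3` ⟹ `q ∣ F₁`. -/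
theorem rootwiseEisenstein_of_eisensteinRationalInclusion (hP1 : EisensteinRationalInclusionAtThree) :
    RootwiseEisensteinAtThree := by
  intro W _ _ N _ K _ _ Dt hO6 hsurj hr1 hN hK hH κ hκ γ _ 𝔭 h𝔭 he hf 𝔭' h𝔭' hne ι' hι ΩK Ωp L hΩK hΩp hL htor _hL0
    F₁ L₁ u b hCh hu hLeq q hq hq3 hqL₁
  obtain ⟨k, hk⟩ := hP1 W N K Dt hO6 hsurj hr1 hN hK hH κ hκ γ 𝔭 h𝔭 he hf 𝔭' h𝔭' hne ι' hι ΩK Ωp L hΩK hΩp hL htor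
  have hFmem : F₁ ^ 2 ∈ (AcSelmer.XAc.charIdeal (W.baseChange K) 3 κ 𝔭' ∅ γ).map (PowerSeries.map (Halves.toUnr 3)) := by
    rw [hCh]; exact Ideal.mem_span_singleton_self _
  have hdvd : q ∣ ((3 : ℕ) : UnrSeries 3) ^ k * F₁ ^ 2 := hqL₁.trans (sqRoot_dvd_of_P1 hLeq (hk (F₁ ^ 2) hFmem))
  rcases hq.dvd_or_dvd hdvd with h3k | hF2
  · exact absurd (hq.dvd_of_dvd_pow h3k) hq3
  · exact hq.dvd_of_dvd_pow hF2

/-- **WEAKER-certificate 2: P1 ⟹ (MZ).** `qᵐ ∣ L₁` ⟹ `q²ᵐ ∣ L₁² ∣ L ∣ 3ᵏ·F₁²` ⟹ (`q ∤ 3`) `q²ᵐ ∣ F₁²` ⟹ `qᵐ ∣ F₁`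
(multiplicities in the factorial ring `R₀⟦T⟧`). -/
theorem multipleZeroMultiplicity_of_eisensteinRationalInclusion (hP1 : EisensteinRationalInclusionAtThree) :
    MultipleZeroMultiplicityAtThree := by
  intro W _ _ N _ K _ _ Dt hO6 hsurj hr1 hN hK hH κ hκ γ _ 𝔭 h𝔭 he hf 𝔭' h𝔭' hne ι' hι ΩK Ωp L hΩK hΩp hL htor _hL0
    F₁ L₁ u b hCh hu hLeq q m hq hq3 _hqq hqm
  obtain ⟨k, hk⟩ := hP1 W N K Dt hO6 hsurj hr1 hN hK hH κ hκ γ 𝔭 h𝔭 he hf 𝔭' h𝔭' hne ι' hι ΩK Ωp L hΩK hΩp hL htor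
  have hFmem : F₁ ^ 2 ∈ (AcSelmer.XAc.charIdeal (W.baseChange K) 3 κ 𝔭' ∅ γ).map (PowerSeries.map (Halves.toUnr 3)) := by
    rw [hCh]; exact Ideal.mem_span_singleton_self _
  have h1 : (3 : UnrSeries 3) ^ k * F₁ ^ 2 ∈ Ideal.span ({L} : Set (UnrSeries 3)) := hk (F₁ ^ 2) hFmem
  have h3 : (3 : UnrSeries 3) = ((3 : ℕ) : UnrSeries 3) := by rw [Nat.cast_ofNat]
  rw [h3, Ideal.mem_span_singleton] at h1
  -- `L₁² ∣ L ∣ 3^k F₁²`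
  have hL₁2 : L₁ ^ 2 ∣ ((3 : ℕ) : UnrSeries 3) ^ k * F₁ ^ 2 :=
    (Dvd.intro_left (u * ((3 : ℕ) : UnrSeries 3) ^ b) (by rw [hLeq])).trans h1
  have hq2m : q ^ (2 * m) ∣ ((3 : ℕ) : UnrSeries 3) ^ k * F₁ ^ 2 := by
    rw [mul_comm 2 m, pow_mul]; exact (pow_dvd_pow_of_dvd hqm 2).trans hL₁2
  have h3k : ¬ q ∣ ((3 : ℕ) : UnrSeries 3) ^ k := fun h => hq3 (hq.dvd_of_dvd_pow h)
  have hqF2 : q ^ (2 * m) ∣ F₁ ^ 2 := hq.pow_dvd_of_dvd_mul_left (2 * m) h3k hq2m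
  by_cases hF₁ : F₁ = 0
  · rw [hF₁]; exact dvd_zero _
  haveI := uniqueFactorizationMonoid_unrSeries
  letI : StrongNormalizationMonoid (UnrSeries 3) := UniqueFactorizationMonoid.strongNormalizationMonoid
  have hle : ((2 * m : ℕ) : ℕ∞) ≤ 2 * emultiplicity q F₁ := by
    have := (pow_dvd_iff_le_emultiplicity).mp hqF2
    rwa [emultiplicity_pow hq] at this
  rw [UniqueFactorizationMonoid.emultiplicity_eq_count_normalizedFactors hq.irreducible hF₁] at hle
  have hle' : 2 * m ≤ 2 * Multiset.count (normalize q) (UniqueFactorizationMonoid.normalizedFactors F₁) := by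
    exact_mod_cast hle
  rw [pow_dvd_iff_le_count hq.irreducible hF₁]
  omega

/-! ## §D  g0's λ-flip VERBATIM (credit: gen 0, `NodeEisensteinKatoSwapG0.lean`): P1 ∧ P2 ⟹ 24207 — here restated to consume P1 only under
the guard `L ≠ 0` (which is exactly how g0's proof uses it). -/

/-- g0's door with P1 weakened to its `L ≠ 0`-guarded form (the only form g0's proof consumes). Proof text = g0's, verbatim up to the guard. -/
theorem rationalSplitIMCInclusionAtThree_of_eisensteinNeZero_of_lambdaDominance
    (hE : ∀ (W : WeierstrassCurve ℚ) [W.IsElliptic] [W.IsGloballyMinimal] (N : ℕ) [NeZero N] (K : Type) [Field K] [NumberField K] (Dt : Literature.NumberTheory.EllipticCurves.ModularForms.ModularParametrizationData W N), Summit.BirchSwinnertonDyer.Rank1Residual.Additive.ClassO6 W 3 → W.HasSurjectiveModNGaloisRep 3 → W.analyticRank = 1 → W.conductorNorm ℤ = N → Literature.NumberTheory.EllipticCurves.IsImaginaryQuadratic K → Literature.NumberTheory.EllipticCurves.SatisfiesHeegnerHypothesis N K → ∀ (κ : Literature.NumberTheory.EllipticCurves.ZpExtension K 3), κ.IsAnticyclotomic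 → ∀ (γ : Field.absoluteGaloisGroup K) [Fact (κ.IsTopGenerator γ)] (𝔭 : IsDedekindDomain.HeightOneSpectrum (NumberField.RingOfIntegers K)), ((3 : ℕ) : NumberField.RingOfIntegers K) ∈ 𝔭.asIdeal → 𝔭.asIdeal.ramificationIdx (NumberField.RingOfIntegers ℚ) = 1 → 𝔭.asIdeal.inertiaDeg (NumberField.RingOfIntegers ℚ) = 1 → ∀ (𝔭' : IsDedekindDomain.HeightOneSpectrum (NumberField.RingOfIntegers K)), ((3 : ℕ) : NumberField.RingOfIntegers K) ∈ 𝔭'.asIdeal → 𝔭' ≠ 𝔭 → ∀ (ι' : PadicAlgCl 3 ≃+* ℂ), Summit.BirchSwinnertonDyer.BirchSwinnertonDyer.Theorems.SchneiderFree.BranchInducesPrime 3 ι' 𝔭 → ∀ (ΩK : ℂ) (Ωp : ℂ_[3]) (L : Literature.NumberTheory.EllipticCurves.UnrSeries 3), ΩK ≠ 0 → Ωp ≠ 0 → Literature.NumberTheory.EllipticCurves.IsBDPLFunction ι' 𝔭 κ γ Dt.f ΩK Ωp L → Module.IsTorsion (Literature.NumberTheory.EllipticCurves.IwasawaAlgebra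 3) (Summit.BirchSwinnertonDyer.Rank1Residual.X11b.AcSelmer.XAc (W.baseChange K) 3 κ 𝔭' ∅ γ) → L ≠ 0 → ∃ k : ℕ, ∀ x ∈ ((Summit.BirchSwinnertonDyer.Rank1Residual.X11b.AcSelmer.XAc.charIdeal (W.baseChange K) 3 κ 𝔭' ∅ γ).map (PowerSeries.map (Summit.BirchSwinnertonDyer.Rank1Residual.X11b.Halves.toUnr 3))), (3 : Literature.NumberTheory.EllipticCurves.UnrSeries 3) ^ k * x ∈ Ideal.span {L})
    (hD : CharLambdaDominanceAtThree) :
    Summit.BirchSwinnertonDyer.BirchSwinnertonDyer.Theses.UniversalToricDescent.RationalSplitIMCInclusionAtThree := by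
  intro W _ _ N _ K _ _ Dt hO6 hsurj hr1 hN hK hH κ hκ γ _ 𝔭 h𝔭 he hf 𝔭' h𝔭' hne ι' hι ΩK Ωp L hΩK hΩp hL
  by_cases hL0 : L = 0
  · exact ⟨0, by simp [hL0]⟩
  by_cases htor : Module.IsTorsion (IwasawaAlgebra 3) (AcSelmer.XAc (W.baseChange K) 3 κ 𝔭' ∅ γ)
  · obtain ⟨k, hk⟩ :=
      hE W N K Dt hO6 hsurj hr1 hN hK hH κ hκ γ 𝔭 h𝔭 he hf 𝔭' h𝔭' hne ι' hι ΩK Ωp L hΩK hΩp hL htor hL0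
    obtain ⟨F, F₀, L₀, a, m, c, n, hCh, hF, hF₀, hLeq, hL₀, hmn⟩ :=
      hD W N K Dt hO6 hsurj hr1 hN hK hH κ hκ γ 𝔭 h𝔭 he hf 𝔭' h𝔭' hne ι' hι ΩK Ωp L hΩK hΩp hL htor hL0
    have h3 : (3 : UnrSeries 3) = C ((3 : ℕ) : unrIntegers 3) := by
      rw [map_natCast, Nat.cast_ofNat]
    have h3' : ((3 : ℕ) : UnrSeries 3) = C ((3 : ℕ) : unrIntegers 3) := (map_natCast C 3).symm
    have hFmem : F ∈ (AcSelmer.XAc.charIdeal (W.baseChange K) 3 κ 𝔭' ∅ γ).map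
        (PowerSeries.map (Halves.toUnr 3)) := by
      rw [hCh]; exact Ideal.mem_span_singleton_self F
    have h1 := hk F hFmem
    have hLL₀ : Ideal.span ({L} : Set (UnrSeries 3)) ≤ Ideal.span {L₀} := by
      rw [Ideal.span_singleton_le_span_singleton, hLeq]
      exact Dvd.intro_left _ rfl
    have h2 : C (((3 : ℕ) : unrIntegers 3) ^ (k + a)) * F₀ ∈ Ideal.span ({L₀} : Set (UnrSeries 3)) := by
      have heq : (3 : UnrSeries 3) ^ k * F = C (((3 : ℕ) : unrIntegers 3) ^ (k + a)) * F₀ := by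
        rw [hF, h3, pow_add, map_mul, map_pow, map_pow]; ring
      rw [← heq]; exact hLL₀ h1
    obtain ⟨hspan, -⟩ := span_singleton_eq_of_C_pow_mul_mem_of_le (p := 3) h2 hL₀ hF₀ hmn
    have hL₀mem : L₀ ∈ Ideal.span ({F₀} : Set (UnrSeries 3)) := by
      rw [← hspan]; exact Ideal.mem_span_singleton_self L₀
    obtain ⟨h, hh⟩ := Ideal.mem_span_singleton'.mp hL₀mem
    refine ⟨a, ?_⟩
    rw [hCh, Ideal.mem_span_singleton']
    refine ⟨C (((3 : ℕ) : unrIntegers 3) ^ c) * h, ?_⟩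
    rw [hLeq, ← hh, hF, h3', ← map_pow]; ring
  · refine ⟨0, ?_⟩
    have htop : AcSelmer.XAc.charIdeal (W.baseChange K) 3 κ 𝔭' ∅ γ = ⊤ :=
      Summit.BirchSwinnertonDyer.BirchSwinnertonDyer.Theorems.charIdeal_eq_top_of_not_isTorsion (p := 3) _ htor
    rw [htop, Ideal.map_top]; exact Submodule.mem_top

/-- g0's door BY NAME-shape (P1 ∧ P2 ⟹ 24207), recovered from the guarded form. -/
theorem rationalSplitIMCInclusionAtThree_of_eisenstein_of_lambdaDominance
    (hE : EisensteinRationalInclusionAtThree) (hD : CharLambdaDominanceAtThree) :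
    Summit.BirchSwinnertonDyer.BirchSwinnertonDyer.Theses.UniversalToricDescent.RationalSplitIMCInclusionAtThree :=
  rationalSplitIMCInclusionAtThree_of_eisensteinNeZero_of_lambdaDominance
    (fun W _ _ N _ K _ _ Dt hO6 hsurj hr1 hN hK hH κ hκ γ _ 𝔭 h𝔭 he hf 𝔭' h𝔭' hne ι' hι ΩK Ωp L hΩK hΩp hL htor _ =>
      hE W N K Dt hO6 hsurj hr1 hN hK hH κ hκ γ 𝔭 h𝔭 he hf 𝔭' h𝔭' hne ι' hι ΩK Ωp L hΩK hΩp hL htor) hD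

/-! ## §E  THE DOOR (kernel-checked, concludes the crux BY NAME) -/

/-- **DOOR: (SQ) ∧ (AN) ∧ (RE) ∧ (MZ) ∧ P2 ⟹ `RationalSplitIMCInclusionAtThree`.**  On square rows, ROOTWISE EISENSTEIN EXISTENCE (one
(∅,0)-Selmer class at each zero of `𝓛_𝔭`), MULTIPLICITY only at the multiple zeros (vacuous on simple-zero rows), and the twin's one-sided
degree dominance decide UTD's rational wall. -/
theorem rationalSplitIMCInclusionAtThree_of_rootwiseEisenstein_of_multipleZeros
    (hSQ : SquareCharGeneratorAtThree) (hAN : SquareRootLFunctionAtThree)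
    (hRE : RootwiseEisensteinAtThree) (hMZ : MultipleZeroMultiplicityAtThree) (hD : CharLambdaDominanceAtThree) :
    Summit.BirchSwinnertonDyer.BirchSwinnertonDyer.Theses.UniversalToricDescent.RationalSplitIMCInclusionAtThree :=
  rationalSplitIMCInclusionAtThree_of_eisensteinNeZero_of_lambdaDominance
    (eisensteinRationalInclusion_of_rootwise_of_multiple_ne_zero hSQ hAN hRE hMZ) hD


end Summit.BirchSwinnertonDyer.BirchSwinnertonDyer.Cruxes.RationalSplitIMCInclusionAtThree.RootwiseEisensteinSimpleZeros

end
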